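import Mathlib.Geometry.Manifold.Algebra.LieGroup
import Literature.NumberTheory.Transcendental.AnalytificationProduct
import Literature.NumberTheory.Transcendental.AnalytificationSeparatedProofs
import Literature.NumberTheory.Transcendental.AnalytificationCompactProofs
import Literature.AlgebraicGeometry.Motives.AbelianVarietyComplexPoints
import Literature.AlgebraicGeometry.HodgeTheory.AbelianVarietyHodgeFullnessOfUniformisation
import Literature.Analysis.Complex.OsgoodProofs
import HarnessLib

/-!
# The analytification of a complex abelian variety is a commutative complex Lie group

Family `hodge`, layer `Literature/NumberTheory/Transcendental`, next to `Analytification.lean` (the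
predicate `IsAnalytification E X d φ`: `φ : M → X(ℂ)` exhibits the complex charted space `M` as
`X^an`) and `AnalytificationProduct.lean` (`(X ×ₖ Y)^an = X^an × Y^an`, functoriality into and out
of products).  Mumford, *Abelian Varieties* §1 (1): «Let `X` be an abelian variety over `ℂ` … `X`
is a compact complex analytic connected Lie group»; Lange–Birkenhake, *Complex Abelian Varieties*
§1.1 (a complex torus is a connected compact complex Lie group, and conversely, Lemma 1.1.2);
Shimura, *Abelian Varieties with Complex Multiplication* §3.1 (analytic coordinate systems).
This file PROVES the Lie-group half on the tree's carriers, with no new definition and no named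
fact:

* `contMDiff_omega_of_mdifferentiable` — the tool: a holomorphic (`MDifferentiable`) map between
  complex manifolds with holomorphic (`C^ω`) atlases is `C^ω` in Mathlib's sense (analytic in
  charts), for any boundaryless complex model (in particular for products `𝓘(ℂ, E).prod 𝓘(ℂ, E')`).
  Osgood's lemma (tree `Literature.Analysis.Complex.SCV.analyticOnNhd_of_differentiableOn`) read in
  extended charts; the `C^∞` version for `𝓘(ℂ, E)` is the tree's
  `MDifferentiable.contMDiff_of_complex` (`ComplexFormsPullback.lean`).
* `IsAnalytification.comp_of_isHomeomorph` — an analytification `φ : M → X(ℂ)` composed with a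
  HOLOMORPHIC HOMEOMORPHISM `e : M' → M` of complex charted spaces (equal model dimensions) is again
  an analytification (`φ ∘ e : M' → X(ℂ)`): the transport clause by which a uniformisation
  `ℂⁿ/Λ ≃ A(ℂ)^an` of the analytification becomes an analytification of `A` by the torus itself.
* `IsAnalytification.exists_lieGroup`, `IsAnalytification.exists_lieAddGroup` — for an abelian
  variety `A` over `ℂ` and ANY analytification `φ : M → A(ℂ)` with a holomorphic atlas, the group
  law of `A(ℂ)` (Mathlib's `Hom.commGroup` on `A(ℂ) = Hom_ℂ(Spec ℂ, A)`, i.e. `P · Q = μ ∘ ⟨P, Q⟩`)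
  transported along the homeomorphism `φ` makes `M` a commutative COMPLEX LIE GROUP
  (`LieGroup 𝓘(ℂ, E) ω M`, resp. `LieAddGroup` for the additively written copy) with `φ` a
  homomorphism: multiplication `M × M → M` is induced by the morphism `μ : A ×_ℂ A → A` on the
  product analytification (`mdifferentiable_of_comp_prod`), inversion by `ι : A → A`
  (`IsAnalytification.mdifferentiable_comp_map_holds`), and holomorphic maps are `C^ω`.
* `AbelianVariety.exists_lieGroup_isAnalytification`,
  `AbelianVariety.exists_lieAddGroup_isAnalytification` — packaged with the existence of the
  analytification (`exists_isAnalytification_holds`): every complex abelian variety `A` has an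
  analytification `φ : G → A(ℂ)` by a compact connected Hausdorff commutative complex Lie group `G`
  of dimension `dim A` (model `ℂ^{dim A}`) along which `φ` is a group homomorphism — Mumford §1 (1).
* `complexAbelianVariety_torusUniformised_of_lieAddGroup` — the reduction of the
  uniformisation record (U) `HodgeTheory.complexAbelianVariety_torusUniformised` (Shimura §3.1,
  «analytic coordinate-system»; the hypothesis `hU` of
  `HodgeTheory.deligneMilne1982_Thm_6_20_full_of_uniformisation`) to the purely Lie-theoretic
  statement «every compact connected commutative complex Lie group modelled on `ℂⁿ` is, as a complex
  Lie group, a complex torus `ComplexTorus Φ`» (Lange–Birkenhake Lemma 1.1.2), taken here as an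
  explicit hypothesis in the weak form the assembly needs (a holomorphic homeomorphic group
  isomorphism `ComplexTorus Φ ≃+ G`; no holomorphy of the inverse is used).

Not here: Lange–Birkenhake Lemma 1.1.2 itself (the exponential map of a compact commutative complex
Lie group; the cell's row D1-3), hence no unconditional proof of (U).

## References

* D. Mumford, *Abelian Varieties* (1970), §1 (1)–(2). [MumfordAV1970]
* H. Lange, Ch. Birkenhake, *Complex Abelian Varieties* (1992), §1.1, Lemma 1.1.2.
  [LangeBirkenhake1992]
* G. Shimura, *Abelian Varieties with Complex Multiplication and Modular Functions* (1998),
  §3.1. [Shimura1998]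
* J.-P. Serre, *Géométrie algébrique et géométrie analytique* (1956), §2 n°5 (fonctorialité,
  produits). [SerreGAGA1956]
-/

noncomputable section

open scoped Manifold ContDiff Topology
open CategoryTheory AlgebraicGeometry MonoidalCategory Set Function
open Literature.AlgebraicGeometry.Motives (AlgPoints ComplexPoints SchemeOver AbelianVariety)

namespace Literature.NumberTheory.Transcendental

/-! ### Holomorphic maps are `C^ω` -/

section Omega

variable {E₁ : Type*} [NormedAddCommGroup E₁] [NormedSpace ℂ E₁] [FiniteDimensional ℂ E₁]
  {H₁ : Type*} [TopologicalSpace H₁] {I₁ : ModelWithCorners ℂ E₁ H₁} [I₁.Boundaryless]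
  {N : Type*} [TopologicalSpace N] [ChartedSpace H₁ N] [IsManifold I₁ ω N]
  {E₂ : Type*} [NormedAddCommGroup E₂] [NormedSpace ℂ E₂] [CompleteSpace E₂]
  {H₂ : Type*} [TopologicalSpace H₂] {I₂ : ModelWithCorners ℂ E₂ H₂}
  {P : Type*} [TopologicalSpace P] [ChartedSpace H₂ P] [IsManifold I₂ ω P]

/-- **Holomorphic maps are `C^ω`** (Osgood): a holomorphic (= complex-differentiable,
`MDifferentiable`) map between complex manifolds with holomorphic atlases, the source model being
finite-dimensional and boundaryless (e.g. `𝓘(ℂ, E)` or a product `𝓘(ℂ, E).prod 𝓘(ℂ, E')`) and the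
target model space complete, is `C^ω` in Mathlib's sense: read in extended charts it is a
complex-differentiable map on an open set, hence analytic there by Osgood's lemma
(`Literature.Analysis.Complex.SCV.analyticOnNhd_of_differentiableOn`), hence `ContDiffOn ℂ ω`
(`AnalyticOnNhd.contDiffOn_of_completeSpace`). Voisin (2002), §1.2.1 Thm. 1.17 (holomorphic ⇔
analytic); Hörmander (1973), Thms. 2.2.1, 2.2.6; Lange–Birkenhake §1.1 uses «holomorphic» and
«complex Lie group» in exactly this sense. [cite: VoisinHodgeI2002, §1.2.1 Thm. 1.17]
[cite: HormanderSCV1973, Thm 2.2.1 and Thm 2.2.6] -/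
theorem contMDiff_omega_of_mdifferentiable {f : N → P} (hf : MDifferentiable I₁ I₂ f) :
    ContMDiff I₁ I₂ ω f := by
  haveI : IsManifold I₁ 1 N := inferInstance
  haveI : IsManifold I₂ 1 P := inferInstance
  rw [contMDiff_iff]
  refine ⟨hf.continuous, fun x y ↦ ?_⟩
  set s : Set E₁ := (extChartAt I₁ x).target ∩
    (extChartAt I₁ x).symm ⁻¹' (f ⁻¹' (extChartAt I₂ y).source) with hs_def
  have hs : IsOpen s :=
    (continuousOn_extChartAt_symm x).isOpen_inter_preimage (isOpen_extChartAt_target x)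
      ((isOpen_extChartAt_source y).preimage hf.continuous)
  have hd : DifferentiableOn ℂ (extChartAt I₂ y ∘ f ∘ (extChartAt I₁ x).symm) s := by
    intro z hz
    have hz₁ : z ∈ (extChartAt I₁ x).target := hz.1
    have hx' : (extChartAt I₁ x).symm z ∈ (chartAt H₁ x).source := by
      rw [← extChartAt_source (I := I₁)]
      exact (extChartAt I₁ x).map_target hz₁
    have hy' : f ((extChartAt I₁ x).symm z) ∈ (chartAt H₂ y).source := by
      rw [← extChartAt_source (I := I₂)]
      exact hz.2
    have h := ((mdifferentiableAt_iff_of_mem_source hx' hy').1 (hf _)).2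
    rw [(extChartAt I₁ x).right_inv hz₁, ModelWithCorners.Boundaryless.range_eq_univ,
      differentiableWithinAt_univ] at h
    exact h.differentiableWithinAt
  exact (Literature.Analysis.Complex.SCV.analyticOnNhd_of_differentiableOn hd hs)
    |>.contDiffOn_of_completeSpace

end Omega

/-! ### Transport of an analytification along a holomorphic homeomorphism -/

section Transport

variable {E : Type*} [NormedAddCommGroup E] [NormedSpace ℂ E] [FiniteDimensional ℂ E]
  {E' : Type*} [NormedAddCommGroup E'] [NormedSpace ℂ E'] [FiniteDimensional ℂ E']
  {M : Type*} [TopologicalSpace M] [ChartedSpace E M]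
  {M' : Type*} [TopologicalSpace M'] [ChartedSpace E' M']
  {k : Type} [Field k] [Algebra k ℂ] {X : SchemeOver k} {d : ℕ} {φ : M → ComplexPoints X}

/-- **Transport of the analytification along a holomorphic homeomorphism.** If `φ : M → X(ℂ)` is an
analytification of `X` (model `E`) and `e : M' → M` is a homeomorphism from a complex charted space
modelled on `E'`, `finrank E' = finrank E`, which is holomorphic (`MDifferentiable`), then
`φ ∘ e : M' → X(ℂ)` is an analytification of `X` (model `E'`): it is a homeomorphism, and a regular
function pulled back along `φ ∘ e` is the holomorphic function `s ∘ φ` composed with the holomorphic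
`e`. (Serre, GAGA §2: `X^h` is well defined up to unique isomorphism; this is the clause letting a
biholomorphic model — e.g. a complex torus uniformising `A(ℂ)` — serve as THE analytification.)
[cite: SerreGAGA1956, §2 (unicité de X^h)] -/
theorem IsAnalytification.comp_of_isHomeomorph (hφ : IsAnalytification E X d φ) {e : M' → M}
    (he : IsHomeomorph e) (hed : MDifferentiable 𝓘(ℂ, E') 𝓘(ℂ, E) e)
    (hdim : Module.finrank ℂ E' = Module.finrank ℂ E) :
    IsAnalytification E' X d (φ ∘ e) where
  isHomeomorph := hφ.isHomeomorph.comp he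
  finrank_eq := by rw [hdim, hφ.finrank_eq]
  mdifferentiableOn_evalOrZero U s :=
    (hφ.mdifferentiableOn_evalOrZero U s).comp hed.mdifferentiableOn (fun _ hm ↦ hm)

end Transport

/-! ### The group law of an abelian variety on its analytification -/

section AbelianVariety

open scoped MonObj

variable {A : AbelianVariety ℂ}
  {E : Type*} [NormedAddCommGroup E] [NormedSpace ℂ E] [FiniteDimensional ℂ E]
  {M : Type*} [TopologicalSpace M] [ChartedSpace E M] [IsManifold 𝓘(ℂ, E) ω M]
  {φ : M → ComplexPoints A.X}

/-- **The transported group law is holomorphic.** For an analytification `φ : M → A(ℂ)` of a complex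
abelian variety with a holomorphic atlas, the binary operation `(x, y) ↦ φ⁻¹(φ x · φ y)` on `M` is
holomorphic for the product complex structure — it is the map induced by the group law
`μ : A ×_ℂ A → A` on the product analytification `M × M` of `A ×_ℂ A`
(`mdifferentiable_of_comp_prod`, Serre GAGA §2 n°5) — and `x ↦ φ⁻¹((φ x)⁻¹)` is holomorphic, being
induced by the inversion morphism `ι : A → A` (`IsAnalytification.mdifferentiable_comp_map_holds`).
Mumford §1 (1). [cite: MumfordAV1970, §1 (1)] -/
theorem IsAnalytification.mdifferentiable_mul_inv_transport
    (hφ : IsAnalytification E A.X A.dim φ) :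
    MDifferentiable (𝓘(ℂ, E).prod 𝓘(ℂ, E)) 𝓘(ℂ, E)
        (fun p : M × M ↦ hφ.homeomorph.symm (φ p.1 * φ p.2)) ∧
      MDifferentiable 𝓘(ℂ, E) 𝓘(ℂ, E) (fun x : M ↦ hφ.homeomorph.symm (φ x)⁻¹) := by
  haveI : SmoothOfRelativeDimension A.dim A.X.hom :=
    (Literature.AlgebraicGeometry.Motives.AbelianVariety.isSmoothProjective_holds
      (A := A)).smoothOfRelativeDimension
  refine ⟨?_, ?_⟩
  · refine mdifferentiable_of_comp_prod hφ hφ hφ μ[A.X] _ fun p ↦ ?_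
    -- `φ (φ⁻¹ (φ p.1 · φ p.2)) = φ p.1 · φ p.2 = μ(ℂ)(φ p.1, φ p.2)` (the last step is `rfl`)
    exact hφ.homeomorph.apply_symm_apply _
  · refine IsAnalytification.mdifferentiable_comp_map_holds hφ hφ ι[A.X] _ (funext fun x ↦ ?_)
    -- `φ (φ⁻¹ ((φ x)⁻¹)) = (φ x)⁻¹ = ι(ℂ)(φ x)` (the last step is `rfl`)
    exact hφ.homeomorph.apply_symm_apply _

/-- **An analytification of a complex abelian variety is a commutative complex Lie group**
(Mumford, *Abelian Varieties* §1 (1): «`X` is a compact complex analytic connected Lie group»;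
multiplicative form). For `A` an abelian variety over `ℂ` and ANY analytification `φ : M → A(ℂ)`
carrying a holomorphic atlas, the group structure of `A(ℂ)` transported along the homeomorphism `φ`
(so that `φ (x · y) = φ x · φ y`) makes `M` a `LieGroup 𝓘(ℂ, E) ω`: multiplication is the
holomorphic map `M × M → M` induced by the group law `μ : A ×_ℂ A → A` on the product
analytification, inversion the one induced by `ι : A → A`
(`IsAnalytification.mdifferentiable_mul_inv_transport`), and holomorphic maps are `C^ω`
(`contMDiff_omega_of_mdifferentiable`). [cite: MumfordAV1970, §1 (1)] -/
theorem IsAnalytification.exists_lieGroup (hφ : IsAnalytification E A.X A.dim φ) :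
    ∃ _ : CommGroup M, LieGroup 𝓘(ℂ, E) ω M ∧ ∀ x y, φ (x * y) = φ x * φ y := by
  obtain ⟨hm, hi⟩ := hφ.mdifferentiable_mul_inv_transport
  letI : CommGroup M := hφ.homeomorph.toEquiv.commGroup
  have hmul : ∀ x y : M, φ (x * y) = φ x * φ y := fun x y ↦
    hφ.homeomorph.toEquiv.apply_symm_apply _
  refine ⟨inferInstance, ?_, hmul⟩
  exact
    { contMDiff_mul := contMDiff_omega_of_mdifferentiable hm
      contMDiff_inv := contMDiff_omega_of_mdifferentiable hi }

/-- **An analytification of a complex abelian variety is a commutative complex Lie group**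
(Mumford §1 (1); additively written form, matching the additive complex tori `ComplexTorus Φ` of
`Literature.Geometry.Kaehler`): for ANY analytification `φ : M → A(ℂ)` with a holomorphic atlas
there is an `AddCommGroup` structure on `M` with `LieAddGroup 𝓘(ℂ, E) ω M` along which `φ` is a
homomorphism to the (multiplicatively written) group `A(ℂ)`: `φ (x + y) = φ x · φ y`.
[cite: MumfordAV1970, §1 (1)] -/
theorem IsAnalytification.exists_lieAddGroup (hφ : IsAnalytification E A.X A.dim φ) :
    ∃ _ : AddCommGroup M, LieAddGroup 𝓘(ℂ, E) ω M ∧ ∀ x y, φ (x + y) = φ x * φ y := by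
  obtain ⟨hm, hi⟩ := hφ.mdifferentiable_mul_inv_transport
  letI : AddCommGroup M := (hφ.homeomorph.toEquiv.trans Additive.ofMul).addCommGroup
  have hadd : ∀ x y : M, φ (x + y) = φ x * φ y := fun x y ↦
    hφ.homeomorph.toEquiv.apply_symm_apply _
  refine ⟨inferInstance, ?_, hadd⟩
  exact
    { contMDiff_add := contMDiff_omega_of_mdifferentiable hm
      contMDiff_neg := contMDiff_omega_of_mdifferentiable hi }

/-- **A complex abelian variety is a compact connected commutative complex Lie group** (Mumford,
*Abelian Varieties* §1 (1); Lange–Birkenhake §1.1; multiplicative form): for `A` an abelian variety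
over `ℂ` there is a compact connected Hausdorff commutative complex Lie group `G` modelled on
`ℂ^{dim A}` (holomorphic atlas) and a group homomorphism `φ : G → A(ℂ)` which is THE
ANALYTIFICATION of `A` (`IsAnalytification`). Assembled from the existence of the analytification
(`exists_isAnalytification_holds`, Serre GAGA §2), its compactness (`A` proper) and connectedness
(`A(ℂ)` connected), and `IsAnalytification.exists_lieGroup`. [cite: MumfordAV1970, §1 (1)] -/
theorem _root_.Literature.AlgebraicGeometry.Motives.AbelianVariety.exists_lieGroup_isAnalytification
    (A : AbelianVariety ℂ) :
    ∃ (G : Type) (_ : CommGroup G) (_ : TopologicalSpace G) (_ : T2Space G) (_ : CompactSpace G)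
      (_ : ConnectedSpace G) (_ : ChartedSpace (Fin A.dim → ℂ) G)
      (_ : LieGroup 𝓘(ℂ, Fin A.dim → ℂ) ω G) (φ : G → ComplexPoints A.X),
      IsAnalytification (Fin A.dim → ℂ) A.X A.dim φ ∧ ∀ x y, φ (x * y) = φ x * φ y := by
  haveI : SmoothOfRelativeDimension A.dim A.X.hom :=
    (Literature.AlgebraicGeometry.Motives.AbelianVariety.isSmoothProjective_holds
      (A := A)).smoothOfRelativeDimension
  obtain ⟨G, _, _, _, _, φ, hφ⟩ := exists_isAnalytification_holds A.X A.dim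
  obtain ⟨_, hL, hmul⟩ := hφ.exists_lieGroup
  haveI : CompactSpace G := IsAnalytification.compactSpace_holds hφ
  haveI : ConnectedSpace G := hφ.homeomorph.connectedSpace_iff.2 inferInstance
  exact ⟨G, inferInstance, inferInstance, inferInstance, inferInstance, inferInstance,
    inferInstance, hL, φ, hφ, hmul⟩

/-- **A complex abelian variety is a compact connected commutative complex Lie group** (Mumford §1
(1); additively written form): there is a compact connected Hausdorff `AddCommGroup` `G` with
`LieAddGroup 𝓘(ℂ, ℂ^{dim A}) ω G` and an analytification `φ : G → A(ℂ)` of `A` with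
`φ (x + y) = φ x · φ y`. This is the input «`A(ℂ)` is a connected compact complex Lie group of
dimension `g`» of Lange–Birkenhake Lemma 1.1.2 / Shimura §3.1 in the uniformisation of `A`.
[cite: MumfordAV1970, §1 (1)] -/
theorem
    _root_.Literature.AlgebraicGeometry.Motives.AbelianVariety.exists_lieAddGroup_isAnalytification
    (A : AbelianVariety ℂ) :
    ∃ (G : Type) (_ : AddCommGroup G) (_ : TopologicalSpace G) (_ : T2Space G)
      (_ : CompactSpace G) (_ : ConnectedSpace G) (_ : ChartedSpace (Fin A.dim → ℂ) G)
      (_ : LieAddGroup 𝓘(ℂ, Fin A.dim → ℂ) ω G) (φ : G → ComplexPoints A.X),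
      IsAnalytification (Fin A.dim → ℂ) A.X A.dim φ ∧ ∀ x y, φ (x + y) = φ x * φ y := by
  haveI : SmoothOfRelativeDimension A.dim A.X.hom :=
    (Literature.AlgebraicGeometry.Motives.AbelianVariety.isSmoothProjective_holds
      (A := A)).smoothOfRelativeDimension
  obtain ⟨G, _, _, _, _, φ, hφ⟩ := exists_isAnalytification_holds A.X A.dim
  obtain ⟨_, hL, hadd⟩ := hφ.exists_lieAddGroup
  haveI : CompactSpace G := IsAnalytification.compactSpace_holds hφ
  haveI : ConnectedSpace G := hφ.homeomorph.connectedSpace_iff.2 inferInstance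
  exact ⟨G, inferInstance, inferInstance, inferInstance, inferInstance, inferInstance,
    inferInstance, hL, φ, hφ, hadd⟩

end AbelianVariety

/-! ### Reduction of the uniformisation record (U) to «compact complex Lie groups are tori» -/

section Uniformisation

open Literature.Geometry.Kaehler (ComplexTorus)
open Literature.AlgebraicGeometry.HodgeTheory (complexAbelianVariety_torusUniformised)

/-- **Uniformisation of complex abelian varieties from Lange–Birkenhake Lemma 1.1.2.** The record
(U) `HodgeTheory.complexAbelianVariety_torusUniformised` ([Shimura1998] §3.1 «analytic
coordinate-system»; the hypothesis `hU` of
`HodgeTheory.deligneMilne1982_Thm_6_20_full_of_uniformisation`) follows from the purely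
Lie-theoretic statement «a connected compact commutative complex Lie group modelled on `ℂⁿ` is a
complex torus» ([LangeBirkenhake1992] Lemma 1.1.2: «Any connected compact complex Lie group `X` of
dimension `g` is a complex torus»), taken as the hypothesis `hLB` in the weak form actually
consumed: a group isomorphism `ComplexTorus Φ ≃+ G`, `Φ : ℝ^ι ≃L[ℝ] ℂⁿ`, that is a homeomorphism
and holomorphic.  Proof: `A(ℂ)^an` is such a Lie group `G` with model `ℂ^{dim A}`
(`AbelianVariety.exists_lieAddGroup_isAnalytification`), and the analytification `φ : G → A(ℂ)`
composed with the holomorphic homeomorphism `ComplexTorus Φ → G` is an analytification by the torus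
(`IsAnalytification.comp_of_isHomeomorph`), additive-to-multiplicative as a composite of
homomorphisms. [cite: LangeBirkenhake1992, §1.1 Lemma 1.1.2] [cite: Shimura1998, §3.1] -/
theorem complexAbelianVariety_torusUniformised_of_lieAddGroup
    (hLB : ∀ (n : ℕ) (G : Type) [AddCommGroup G] [TopologicalSpace G] [T2Space G] [CompactSpace G]
      [ConnectedSpace G] [ChartedSpace (Fin n → ℂ) G] [LieAddGroup 𝓘(ℂ, Fin n → ℂ) ω G],
      ∃ (ι : Type) (_ : Fintype ι) (Φ : (ι → ℝ) ≃L[ℝ] (Fin n → ℂ)) (e : ComplexTorus Φ ≃+ G),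
        IsHomeomorph e ∧ MDifferentiable 𝓘(ℂ, Fin n → ℂ) 𝓘(ℂ, Fin n → ℂ) e) :
    complexAbelianVariety_torusUniformised := by
  classical
  intro A
  obtain ⟨G, _, _, _, _, _, _, _, φ, hφ, hadd⟩ := A.exists_lieAddGroup_isAnalytification
  obtain ⟨ι, _, Φ, e, he, hed⟩ := hLB A.dim G
  refine ⟨ι, inferInstance, inferInstance, Φ, φ ∘ e, hφ.comp_of_isHomeomorph he hed rfl, ?_⟩
  intro x y
  simp only [Function.comp_apply, map_add, hadd]

end Uniformisation

end Literature.NumberTheory.Transcendental
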